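import Summits.QuantumFields.QCD.Theorems.PauliWegnerSeaFMClosureUnquenchedSideWitnessC1Aux5
import Summits.QuantumFields.QCD.Theorems.PauliWegnerSeaFMClosureUnquenchedSideWitnessC1Aux6

/-!
# Side witness, part 7: the tile flow and the side witness on an even box

Crux `FMClosureUnquenched` (stmt-QuantumFields-11512), line `von-mises-circles`, registered sub-goal
`c1_sideWitness : SideWitness`.

On a corner box `{y | ∀ i, OFF c y i < n}` of even side `n ≤ 2S` the sites are tiled by `2 × 2`
squares in the coordinate plane `(i, j)`; running around each square
(`(even, even) → (odd, even) → (odd, odd) → (even, odd) →`) is a fixed-point-free, 2-cycle-free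
neighbour permutation whose out-label `TL` / in-label `EL` at a site only depend on the parities of
its two offsets (`tile_flow`).  The two tile systems in the planes `(0,1)` and `(2,3)` form a flow on
the even box `ebox S x r` in the sense of `flow_sideWitness` (Aux5); hence
`sideWitness_ebox` (= registered `c1_sideWitness_aux7`): for every bare mass some `SU(3)` field makes
the side matrix of the even box invertible.
-/

namespace Summit.QuantumFields.QCD.Theorems.VonMisesCirclesC1

open Matrix Literature.MathematicalPhysics.QuantumLattice Literature.Probability.LatticeModels
open Summit.QuantumFields.QCD.Theorems.VonMisesCircles Literature.MathematicalPhysics.QuantumFieldTheory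

set_option quotPrecheck false in
set_option hygiene false in
/-- The unit step `±e_μ` of label `ℓ = (μ, b)` on the torus of side `2S+1` (`STP`, to keep the
generic-`N` name `STEP` of parts 3–5 free). -/
local notation "STP" ℓ:arg =>
  (if Prod.snd ℓ then -(Pi.single (Prod.fst ℓ) 1 : TorusSite 4 (2 * S + 1)) else Pi.single (Prod.fst ℓ) 1)

set_option quotPrecheck false in
set_option hygiene false in
/-- Offset coordinate `i` of the site `y` from the corner `c`, in `{0, …, 2S}`. -/
local notation "OFF" c:arg y:arg i:arg => (ZMod.val ((y : TorusSite 4 (2 * S + 1)) i - (c : TorusSite 4 (2 * S + 1)) i))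

set_option quotPrecheck false in
/-- Out-label of the `2 × 2`-tile 4-cycle in the plane `(i, j)` at offsets of parities `(u, v)`. -/
local notation "TL" i:arg j:arg u:arg v:arg =>
  (if u % 2 = 0 then (if v % 2 = 0 then ((i, false) : Fin 4 × Bool) else ((j, true) : Fin 4 × Bool))
    else (if v % 2 = 0 then ((j, false) : Fin 4 × Bool) else ((i, true) : Fin 4 × Bool)))

set_option quotPrecheck false in
/-- In-label of the `2 × 2`-tile 4-cycle in the plane `(i, j)` at offsets of parities `(u, v)`. -/
local notation "EL" i:arg j:arg u:arg v:arg =>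
  (if u % 2 = 0 then (if v % 2 = 0 then ((j, true) : Fin 4 × Bool) else ((i, true) : Fin 4 × Bool))
    else (if v % 2 = 0 then ((i, false) : Fin 4 × Bool) else ((j, false) : Fin 4 × Bool)))

set_option quotPrecheck false in
/-- The reversed label. -/
local notation "REV" ℓ:arg => ((Prod.fst ℓ, !(Prod.snd ℓ)) : Fin 4 × Bool)

/-! ## One tile system -/

/-- **The tile 4-cycles in the plane `(i, j)`**: out-move stays in the box and is undone by the
reversed in-label of its target, in-move likewise, and the two labels at a site are perpendicular. -/
theorem tile_flow {S : ℕ} (c : TorusSite 4 (2 * S + 1)) {n : ℕ} (hn2 : n % 2 = 0) (hnS : n ≤ 2 * S)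
    {i j : Fin 4} (hij : i ≠ j) (y : TorusSite 4 (2 * S + 1)) {u v : ℕ} (hyu : OFF c y i = u)
    (hyv : OFF c y j = v) (hu : u < n) (hv : v < n) :
    (OFF c (y + STP (TL i j u v)) i < n ∧ OFF c (y + STP (TL i j u v)) j < n ∧
      (∀ k : Fin 4, k ≠ i → k ≠ j → OFF c (y + STP (TL i j u v)) k = OFF c y k)) ∧
    (EL i j (OFF c (y + STP (TL i j u v)) i) (OFF c (y + STP (TL i j u v)) j) = TL i j u v) ∧
    (OFF c (y + STP (REV (EL i j u v))) i < n ∧ OFF c (y + STP (REV (EL i j u v))) j < n ∧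
      (∀ k : Fin 4, k ≠ i → k ≠ j → OFF c (y + STP (REV (EL i j u v))) k = OFF c y k)) ∧
    (TL i j (OFF c (y + STP (REV (EL i j u v))) i) (OFF c (y + STP (REV (EL i j u v))) j) = EL i j u v) ∧
    ((TL i j u v).1 = i ∨ (TL i j u v).1 = j) ∧ ((EL i j u v).1 = i ∨ (EL i j u v).1 = j) ∧
    ((EL i j u v).1 ≠ (TL i j u v).1) := by
  have hji : j ≠ i := fun h => hij h.symm
  rcases Nat.mod_two_eq_zero_or_one u with hu2 | hu2 <;>
    rcases Nat.mod_two_eq_zero_or_one v with hv2 | hv2 <;>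
    simp only [hu2, hv2, ↓reduceIte, Bool.not_true, Bool.not_false, Bool.false_eq_true, true_or, or_true,
      Nat.one_ne_zero]
  · -- (even, even): out `+e_i`, in from `+e_j`
    have hzi : OFF c (y + Pi.single i 1) i = u + 1 := by
      rw [← hyu]; exact off_add_step_fwd c y i (by omega)
    have hzj : OFF c (y + Pi.single i 1) j = v := by
      rw [← hyv]; exact off_add_step_of_ne c y ((i, false) : Fin 4 × Bool) hji
    have hpj : OFF c (y + Pi.single j 1) j = v + 1 := by
      rw [← hyv]; exact off_add_step_fwd c y j (by omega)
    have hpi : OFF c (y + Pi.single j 1) i = u := by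
      rw [← hyu]; exact off_add_step_of_ne c y ((j, false) : Fin 4 × Bool) hij
    have hu3 : (u + 1) % 2 = 1 := by omega
    have hv3 : (v + 1) % 2 = 1 := by omega
    refine ⟨⟨by omega, by omega, fun k hki hkj => off_add_step_of_ne c y ((i, false) : Fin 4 × Bool) hki⟩,
      ?_, ⟨by omega, by omega, fun k hki hkj => off_add_step_of_ne c y ((j, false) : Fin 4 × Bool) hkj⟩,
      ?_, trivial, trivial, hji⟩
    · rw [hzi, hzj]; simp [hu3, hv2]
    · rw [hpi, hpj]; simp [hu2, hv3]
  · -- (even, odd): out `-e_j`, in from `+e_i`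
    have hzj : OFF c (y + -Pi.single j 1) j = v - 1 := by
      rw [← hyv]; exact off_add_step_bwd c y j (by omega)
    have hzi : OFF c (y + -Pi.single j 1) i = u := by
      rw [← hyu]; exact off_add_step_of_ne c y ((j, true) : Fin 4 × Bool) hij
    have hpi : OFF c (y + Pi.single i 1) i = u + 1 := by
      rw [← hyu]; exact off_add_step_fwd c y i (by omega)
    have hpj : OFF c (y + Pi.single i 1) j = v := by
      rw [← hyv]; exact off_add_step_of_ne c y ((i, false) : Fin 4 × Bool) hji
    have hv3 : (v - 1) % 2 = 0 := by omega
    have hu3 : (u + 1) % 2 = 1 := by omega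
    refine ⟨⟨by omega, by omega, fun k hki hkj => off_add_step_of_ne c y ((j, true) : Fin 4 × Bool) hkj⟩,
      ?_, ⟨by omega, by omega, fun k hki hkj => off_add_step_of_ne c y ((i, false) : Fin 4 × Bool) hki⟩,
      ?_, trivial, trivial, hij⟩
    · rw [hzi, hzj]; simp [hu2, hv3]
    · rw [hpi, hpj]; simp [hu3, hv2]
  · -- (odd, even): out `+e_j`, in from `-e_i`
    have hzj : OFF c (y + Pi.single j 1) j = v + 1 := by
      rw [← hyv]; exact off_add_step_fwd c y j (by omega)
    have hzi : OFF c (y + Pi.single j 1) i = u := by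
      rw [← hyu]; exact off_add_step_of_ne c y ((j, false) : Fin 4 × Bool) hij
    have hpi : OFF c (y + -Pi.single i 1) i = u - 1 := by
      rw [← hyu]; exact off_add_step_bwd c y i (by omega)
    have hpj : OFF c (y + -Pi.single i 1) j = v := by
      rw [← hyv]; exact off_add_step_of_ne c y ((i, true) : Fin 4 × Bool) hji
    have hv3 : (v + 1) % 2 = 1 := by omega
    have hu3 : (u - 1) % 2 = 0 := by omega
    refine ⟨⟨by omega, by omega, fun k hki hkj => off_add_step_of_ne c y ((j, false) : Fin 4 × Bool) hkj⟩,
      ?_, ⟨by omega, by omega, fun k hki hkj => off_add_step_of_ne c y ((i, true) : Fin 4 × Bool) hki⟩,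
      ?_, trivial, trivial, hij⟩
    · rw [hzi, hzj]; simp [hu2, hv3]
    · rw [hpi, hpj]; simp [hu3, hv2]
  · -- (odd, odd): out `-e_i`, in from `-e_j`
    have hzi : OFF c (y + -Pi.single i 1) i = u - 1 := by
      rw [← hyu]; exact off_add_step_bwd c y i (by omega)
    have hzj : OFF c (y + -Pi.single i 1) j = v := by
      rw [← hyv]; exact off_add_step_of_ne c y ((i, true) : Fin 4 × Bool) hji
    have hpj : OFF c (y + -Pi.single j 1) j = v - 1 := by
      rw [← hyv]; exact off_add_step_bwd c y j (by omega)
    have hpi : OFF c (y + -Pi.single j 1) i = u := by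
      rw [← hyu]; exact off_add_step_of_ne c y ((j, true) : Fin 4 × Bool) hij
    have hu3 : (u - 1) % 2 = 0 := by omega
    have hv3 : (v - 1) % 2 = 0 := by omega
    refine ⟨⟨by omega, by omega, fun k hki hkj => off_add_step_of_ne c y ((i, true) : Fin 4 × Bool) hki⟩,
      ?_, ⟨by omega, by omega, fun k hki hkj => off_add_step_of_ne c y ((j, true) : Fin 4 × Bool) hkj⟩,
      ?_, trivial, trivial, hji⟩
    · rw [hzi, hzj]; simp [hu3, hv2]
    · rw [hpi, hpj]; simp [hu2, hv3]

/-! ## The side witness on an even box -/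

/-- **Side witness on an even box** (registered `c1_sideWitness_aux7`): for every bare mass some
`SU(3)` lattice gauge field makes the side matrix of `ebox S x r` (`r + 1 ≤ S`) invertible. -/
theorem sideWitness_ebox (S : ℕ) (x : TorusSite 4 (2 * S + 1)) (r : ℕ) (hr : r + 1 ≤ S) (m₀ : ℝ) :
    ∃ U : GaugeConfig 4 (2 * S + 1) (Matrix.specialUnitaryGroup (Fin 3) ℂ),
      (sideMatrix (ebox S x r) (wilsonD U m₀)).det ≠ 0 := by
  set c : TorusSite 4 (2 * S + 1) := x + Torus.proj (2 * S + 1) (fun _ => -(r : ℤ) - 1) with hc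
  have hA : ∀ y, y ∈ ebox S x r ↔ ∀ i, OFF c y i < 2 * r + 2 := fun y => mem_ebox_iff x hr y
  have hn2 : (2 * r + 2) % 2 = 0 := by omega
  have hnS : 2 * r + 2 ≤ 2 * S := by omega
  have h01 : (0 : Fin 4) ≠ 1 := by decide
  have h23 : (2 : Fin 4) ≠ 3 := by decide
  -- the tile systems at a site of the box
  have T01 := fun (y : TorusSite 4 (2 * S + 1)) (hy : y ∈ ebox S x r) =>
    tile_flow c hn2 hnS h01 y rfl rfl ((hA y).1 hy 0) ((hA y).1 hy 1)
  have T23 := fun (y : TorusSite 4 (2 * S + 1)) (hy : y ∈ ebox S x r) =>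
    tile_flow c hn2 hnS h23 y rfl rfl ((hA y).1 hy 2) ((hA y).1 hy 3)
  -- the flow data
  set D : Fin 2 → TorusSite 4 (2 * S + 1) → Fin 4 × Bool := fun k y =>
    (![TL 0 1 (OFF c y 0) (OFF c y 1), TL 2 3 (OFF c y 2) (OFF c y 3)] : Fin 2 → Fin 4 × Bool) k with hDdef
  set E : Fin 2 → TorusSite 4 (2 * S + 1) → Fin 4 × Bool := fun k y =>
    (![EL 0 1 (OFF c y 0) (OFF c y 1), EL 2 3 (OFF c y 2) (OFF c y 3)] : Fin 2 → Fin 4 × Bool) k with hEdef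
  have hD0 : ∀ y, D 0 y = TL 0 1 (OFF c y 0) (OFF c y 1) := fun y => rfl
  have hD1 : ∀ y, D 1 y = TL 2 3 (OFF c y 2) (OFF c y 3) := fun y => rfl
  have hE0 : ∀ y, E 0 y = EL 0 1 (OFF c y 0) (OFF c y 1) := fun y => rfl
  have hE1 : ∀ y, E 1 y = EL 2 3 (OFF c y 2) (OFF c y 3) := fun y => rfl
  -- membership of the four moved sites
  have hmem : ∀ y ∈ ebox S x r, (y + STP (D 0 y)) ∈ ebox S x r ∧ (y + STP (D 1 y)) ∈ ebox S x r ∧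
      (y + STP (REV (E 0 y))) ∈ ebox S x r ∧ (y + STP (REV (E 1 y))) ∈ ebox S x r := by
    intro y hy
    have hy' := (hA y).1 hy
    obtain ⟨⟨a0, a1, ak⟩, -, ⟨b0, b1, bk⟩, -, -, -, -⟩ := T01 y hy
    obtain ⟨⟨c2, c3, ck⟩, -, ⟨d2, d3, dk⟩, -, -, -, -⟩ := T23 y hy
    rw [hD0, hD1, hE0, hE1, hA, hA, hA, hA]
    refine ⟨fun i => ?_, fun i => ?_, fun i => ?_, fun i => ?_⟩ <;> fin_cases i
    · exact a0
    · exact a1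
    · exact (ak 2 (by decide) (by decide)).trans_lt (hy' 2)
    · exact (ak 3 (by decide) (by decide)).trans_lt (hy' 3)
    · exact (ck 0 (by decide) (by decide)).trans_lt (hy' 0)
    · exact (ck 1 (by decide) (by decide)).trans_lt (hy' 1)
    · exact c2
    · exact c3
    · exact b0
    · exact b1
    · exact (bk 2 (by decide) (by decide)).trans_lt (hy' 2)
    · exact (bk 3 (by decide) (by decide)).trans_lt (hy' 3)
    · exact (dk 0 (by decide) (by decide)).trans_lt (hy' 0)
    · exact (dk 1 (by decide) (by decide)).trans_lt (hy' 1)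
    · exact d2
    · exact d3
  -- labels of the moved sites
  have hlab : ∀ y ∈ ebox S x r, E 0 (y + STP (D 0 y)) = D 0 y ∧ E 1 (y + STP (D 1 y)) = D 1 y ∧
      D 0 (y + STP (REV (E 0 y))) = E 0 y ∧ D 1 (y + STP (REV (E 1 y))) = E 1 y := by
    intro y hy
    obtain ⟨⟨-, -, ak⟩, ha, ⟨-, -, bk⟩, hb, -, -, -⟩ := T01 y hy
    obtain ⟨⟨-, -, ck⟩, hc', ⟨-, -, dk⟩, hd, -, -, -⟩ := T23 y hy
    refine ⟨?_, ?_, ?_, ?_⟩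
    · rw [hE0, hD0]; exact ha
    · rw [hE1, hD1]; exact hc'
    · rw [hD0, hE0]; exact hb
    · rw [hD1, hE1]; exact hd
  -- directions
  have hdir : ∀ y ∈ ebox S x r, ((D 0 y).1 = 0 ∨ (D 0 y).1 = 1) ∧ ((D 1 y).1 = 2 ∨ (D 1 y).1 = 3) ∧
      ((E 0 y).1 = 0 ∨ (E 0 y).1 = 1) ∧ ((E 1 y).1 = 2 ∨ (E 1 y).1 = 3) ∧
      (E 0 y).1 ≠ (D 0 y).1 ∧ (E 1 y).1 ≠ (D 1 y).1 := by
    intro y hy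
    obtain ⟨-, -, -, -, hd0, he0, hp0⟩ := T01 y hy
    obtain ⟨-, -, -, -, hd1, he1, hp1⟩ := T23 y hy
    rw [hD0, hD1, hE0, hE1]
    exact ⟨hd0, hd1, he0, he1, hp0, hp1⟩
  refine flow_sideWitness (ebox S x r) m₀ (fun k y => y + STP (D k y)) (fun k y => y + STP (REV (E k y))) D E
    ?_ ?_ ?_ ?_ ?_ ?_
  · -- hσ
    intro y hy k
    refine ⟨?_, rfl⟩
    fin_cases k
    · exact (hmem y hy).1
    · exact (hmem y hy).2.1
  · -- hd
    intro y hy h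
    obtain ⟨h0, h1, -, -, -, -⟩ := hdir y hy
    have h' := congrArg Prod.fst h
    rcases h0 with h0 | h0 <;> rcases h1 with h1 | h1 <;> rw [h0, h1] at h' <;> exact absurd h' (by decide)
  · -- hπ
    intro y hy k
    refine ⟨?_, rfl, k, ?_⟩
    · fin_cases k
      · exact (hmem y hy).2.2.1
      · exact (hmem y hy).2.2.2
    · fin_cases k
      · exact (hlab y hy).2.2.1
      · exact (hlab y hy).2.2.2
  · -- he
    intro y hy h
    obtain ⟨-, -, h0, h1, -, -⟩ := hdir y hy
    have h' := congrArg Prod.fst h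
    rcases h0 with h0 | h0 <;> rcases h1 with h1 | h1 <;> rw [h0, h1] at h' <;> exact absurd h' (by decide)
  · -- hin
    intro y hy k
    refine ⟨k, ?_, ?_⟩
    · fin_cases k
      · show y + STP (D 0 y) + STP (REV (E 0 (y + STP (D 0 y)))) = y
        rw [(hlab y hy).1, add_assoc, step_add_step_rev, add_zero]
      · show y + STP (D 1 y) + STP (REV (E 1 (y + STP (D 1 y)))) = y
        rw [(hlab y hy).2.1, add_assoc, step_add_step_rev, add_zero]
    · fin_cases k
      · exact (hlab y hy).1
      · exact (hlab y hy).2.1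
  · -- hanti
    intro y hy k k' h
    have h' := congrArg Prod.fst h
    obtain ⟨hd0, hd1, he0, he1, hp0, hp1⟩ := hdir y hy
    fin_cases k <;> fin_cases k'
    · exact hp0 h'
    · change (E 1 y).1 = (D 0 y).1 at h'
      rcases he1 with h1 | h1 <;> rcases hd0 with h0 | h0 <;> rw [h0, h1] at h' <;> exact absurd h' (by decide)
    · change (E 0 y).1 = (D 1 y).1 at h'
      rcases he0 with h0 | h0 <;> rcases hd1 with h1 | h1 <;> rw [h0, h1] at h' <;> exact absurd h' (by decide)
    · exact hp1 h'

/-- **Registered helper `c1_sideWitness_aux7` of crux stmt-QuantumFields-11512** (line `von-mises-circles`,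
sub-goal `c1_sideWitness`): the side witness on an even box. -/
theorem c1_sideWitness_aux7 : ∀ (S : ℕ) (x : TorusSite 4 (2 * S + 1)) (r : ℕ), r + 1 ≤ S → ∀ (m₀ : ℝ), ∃ U : GaugeConfig 4 (2 * S + 1) (Matrix.specialUnitaryGroup (Fin 3) ℂ), (sideMatrix (ebox S x r) (wilsonD U m₀)).det ≠ 0 :=
  fun S x r hr m₀ => sideWitness_ebox S x r hr m₀

end Summit.QuantumFields.QCD.Theorems.VonMisesCirclesC1
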